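/-
Copyright: the b2b-balaban T⁴-continuum CRUX team, row NE7b OWNER lineage `t4-ne7b-p1` (gen 141). Project licence.
-/
import Summits.QuantumFields.BalabanUV.T4Continuum.Spine.NE7b.SupKernelClassThirdLetters
import Summits.QuantumFields.BalabanUV.T4Continuum.Spine.NE7b.SupBlockFourthKernelAverage

/-!
# THE ROW LETTERS OF THE TWO-POINT PIECES OF `∂⁴W` (SCOPING (d13)(2), sixth file; finite sums).  (501)∕(502)'s background-free two-point
# ENTRIES at order four are `E(k^{xyz}, b^t)` (four placements of the lone gradient slot) and `E(g^{xy}, g^{zt})` (three pairings), with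
# `E(a,b) = Σ_w (Dᵀa)_w(Dᵀb)_w∕c`, the third-derivative-entry observables' vectors `k^{xyz}_w = Σ_u|A_{uw}|K4_{xyzu}`, the Hessian-entry vectors
# `g^{xy}_w = Σ_u|A_{uw}|K3_{xyu}` and the gradient vectors `b^v_w = Σ_u|A_{uw}|Hk_{vu}`.  Their fixed-`x` triple sums close on the input's
# letters — the fourth majorant's row letter `k4r` (`Σ_{y,z,u}K4_{xyzu}`) and column letter `k4c` (`Σ_{y,z,t}K4_{yztu}`), the third's `k3r, k3c`,
# the Hessian's `hr, hc`, the factor's `αr, αc`, the plain letters `dr, dc` of `D`: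
#   `Σ_{y,z,t} E(k^{xyz}, b^t) ≤ αr·k4r·(αc·hc)·dr·dc∕c`     (`x` inside the third-derivative entry; the same for the lone slot at `y` or `z`),
#   `Σ_{y,z,t} E(b^x, k^{yzt}) ≤ hr·αr·(αc·k4c)·dr·dc∕c`     (`x` the lone gradient slot),
#   `Σ_{y,z,t} E(g^{xy}, g^{zt}) ≤ αr·k3r·(αc·k3c)·dr·dc∕c`   (each pairing)
# (row NE7b, node U5c; (480) `two_point_family_sum_le`∕`two_point_pair_sum_le`, (469) `hessian_obs_mass_le`, (482) `hessian_obs_colsum`,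
# (456) `whitened_obs_rowsum_le`∕`whitened_obs_colsum_le`∕`whitened_obs_nonneg`, (500) `triple_sum_eq` BY NAME; [folklore] finite sums)

Cell `pub-balaban`, sub-cell `t4`, spine estimate NE7b (`T4WeightBudget.RelWeightBound`; the cell's OWN estimate — NOT PRINTED in
[Bałaban 1983–89], NOT PROVED).  Crux-route work under `Spine/NE7b/` by the row OWNER (`t4-ne7b-p1` gen 141, file (512)) under FREEZE
(0)'s crux-prover clause; NOTHING of Bałaban's is named as a Lean object, valued or asserted; no `T4Continuum/Support` leaf typed; no
`def`, no notation; zero `sorry`.  Imports (BY NAME): the OWNER's (482) `…SupKernelClassThirdLetters` (`hessian_obs_colsum`; through it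
(480) `two_point_family_sum_le`, `two_point_pair_sum_le`, (469) `hessian_obs_mass_le`, (456) `whitened_obs_rowsum_le`, `whitened_obs_colsum_le`,
`whitened_obs_nonneg`), (500) `…SupBlockFourthKernelAverage` (`triple_sum_eq`).

WHAT IS PROVED ([folklore]; finite sums):
* §1 `third_vector_nonneg`, `third_vector_mass_le` (`Σ_{y,z}Σ_w k^{xyz}_w ≤ αr·k4r`), `third_vector_colsum_le` (`Σ_{y,z,t} k^{yzt}_w ≤ αc·k4c`).
* §2 THE ENDS **`two_point_lone_last_sum_le`**, **`two_point_lone_first_sum_le`**, **`two_point_pairing_sum_le`**; §3 toy.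

HONEST (what this is NOT).  Bookkeeping of the two-point pieces' row letters; the assembly of all the order-4 pieces ((500), (501)∕(502)+this
file, (507)–(511), (496)–(499)+(505)) waits for the cumulant FORM of `∂⁴W` (`U ∈ C⁴`), NOT typed; the order-4 class-map block is NOT typed.
Scalar skeleton ((A3), NC-NE7b-α UNRULED); nothing of Bałaban's asserted.  BY-NAME EFFECT ON THE WALL: NONE.  NE7b NOT PRINTED ∕ NOT PROVED;
spine PROVED 0∕9; rung (B)+1 — the programme's measures remain FINITE-torus statements; NOT the mass gap, NOT Clay.  HONEST DEPENDENCY: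
continuum YM on T⁴ ⇐ BetaPertH ∧ nine spine estimates (0∕9 proved); BetaPertH ⇐ (D1) ∧ (D4) ∧ CAP+tail; G-an2-4 gates asym, D1 and NE2∕3∕4.
-/

set_option autoImplicit false
set_option maxSynthPendingDepth 3

noncomputable section

namespace Summit.QuantumFields.BalabanUV.T4Continuum.NE7b.SupFourthKernelTwoPointLetters

open MeasureTheory ProbabilityTheory Finset Real Matrix
open scoped BigOperators Matrix
open SupThirdKernelEntryLetters (two_point_family_sum_le two_point_pair_sum_le)
open SupWhitenedHessianGradientCovariance (hessian_obs_mass_le)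
open SupKernelClassThirdLetters (hessian_obs_colsum)
open SupWhitenedFirstOrderLetters (whitened_obs_rowsum_le whitened_obs_colsum_le whitened_obs_nonneg)
open SupBlockFourthKernelAverage (triple_sum_eq)

variable {ι κ : Type} [Fintype ι] [DecidableEq ι] [Fintype κ] [DecidableEq κ]

variable {A : Matrix ι κ ℝ} {Hk : ι → ι → ℝ} {K3 : ι → ι → ι → ℝ} {K4 : ι → ι → ι → ι → ℝ} {D : κ → κ → ℝ}
  {αr αc hr hc k3r k3c k4r k4c dr dc c : ℝ}

/-! ## §1. The third-derivative-entry observables' vectors `k^{xyz}_w = Σ_u|A_{uw}|K4_{xyzu}`: masses -/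

omit [DecidableEq ι] [Fintype κ] [DecidableEq κ] in
/-- `k^{xyz}_w ≥ 0` for `K4 ≥ 0`. [folklore] -/
theorem third_vector_nonneg (hK40 : ∀ x y z u, 0 ≤ K4 x y z u) (A : Matrix ι κ ℝ) (x y z : ι) (w : κ) : 0 ≤ ∑ u, |A u w| * K4 x y z u :=
  Finset.sum_nonneg fun u _ => mul_nonneg (abs_nonneg _) (hK40 x y z u)

omit [DecidableEq ι] [DecidableEq κ] in
/-- **The mass over `(y,z)`**: `Σ_yΣ_zΣ_w k^{xyz}_w ≤ αr·k4r` (`Σ_w|A_{uw}| ≤ αr`, `Σ_{y,z,u}K4_{xyzu} ≤ k4r`, `K4 ≥ 0`). [folklore] -/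
theorem third_vector_mass_le (hK40 : ∀ x y z u, 0 ≤ K4 x y z u) (hαr : ∀ u, ∑ w, |A u w| ≤ αr) (hk4r : ∀ x, ∑ y, ∑ z, ∑ u, K4 x y z u ≤ k4r)
    (x : ι) : ∑ y, ∑ z, ∑ w, ∑ u, |A u w| * K4 x y z u ≤ αr * k4r := by
  rcases isEmpty_or_nonempty ι with hι | ⟨⟨u₀⟩⟩
  · exact (hι.false x).elim
  have hαr0 : 0 ≤ αr := (Finset.sum_nonneg fun w _ => abs_nonneg (A u₀ w)).trans (hαr u₀)
  have hin : ∀ y z, ∑ w, ∑ u, |A u w| * K4 x y z u ≤ αr * ∑ u, K4 x y z u := fun y z => by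
    rw [Finset.sum_comm, Finset.mul_sum]
    refine Finset.sum_le_sum fun u _ => ?_
    calc ∑ w, |A u w| * K4 x y z u = (∑ w, |A u w|) * K4 x y z u := (Finset.sum_mul _ _ _).symm
      _ ≤ αr * K4 x y z u := mul_le_mul_of_nonneg_right (hαr u) (hK40 x y z u)
  calc ∑ y, ∑ z, ∑ w, ∑ u, |A u w| * K4 x y z u ≤ ∑ y, ∑ z, αr * ∑ u, K4 x y z u :=
        Finset.sum_le_sum fun y _ => Finset.sum_le_sum fun z _ => hin y z
    _ = αr * ∑ y, ∑ z, ∑ u, K4 x y z u := by simp only [Finset.mul_sum]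
    _ ≤ αr * k4r := mul_le_mul_of_nonneg_left (hk4r x) hαr0

omit [DecidableEq ι] [Fintype κ] [DecidableEq κ] in
/-- **The column over `(y,z,t)`**: `Σ_yΣ_zΣ_t k^{yzt}_w ≤ αc·k4c` (`Σ_u|A_{uw}| ≤ αc`, `Σ_{y,z,t}K4_{yztu} ≤ k4c`, `K4 ≥ 0`). [folklore] -/
theorem third_vector_colsum_le [Nonempty ι] (hK40 : ∀ x y z u, 0 ≤ K4 x y z u) (hαc : ∀ w, ∑ u, |A u w| ≤ αc)
    (hk4c : ∀ u, ∑ y, ∑ z, ∑ t, K4 y z t u ≤ k4c) (w : κ) : ∑ y, ∑ z, ∑ t, ∑ u, |A u w| * K4 y z t u ≤ αc * k4c := by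
  obtain ⟨u₀⟩ := ‹Nonempty ι›
  have hk4c0 : 0 ≤ k4c :=
    (Finset.sum_nonneg fun y _ => Finset.sum_nonneg fun z _ => Finset.sum_nonneg fun t _ => hK40 y z t u₀).trans (hk4c u₀)
  have e1 : ∑ y, ∑ z, ∑ t, ∑ u, |A u w| * K4 y z t u = ∑ p : ι × ι × ι, ∑ u, |A u w| * K4 p.1 p.2.1 p.2.2 u :=
    (triple_sum_eq (fun y z t => ∑ u, |A u w| * K4 y z t u)).symm
  rw [e1, Finset.sum_comm]
  calc ∑ u, ∑ p : ι × ι × ι, |A u w| * K4 p.1 p.2.1 p.2.2 u = ∑ u, |A u w| * ∑ p : ι × ι × ι, K4 p.1 p.2.1 p.2.2 u :=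
        Finset.sum_congr rfl fun u _ => (Finset.mul_sum _ _ _).symm
    _ ≤ ∑ u, |A u w| * k4c := Finset.sum_le_sum fun u _ =>
        mul_le_mul_of_nonneg_left (by rw [triple_sum_eq (fun y z t => K4 y z t u)]; exact hk4c u) (abs_nonneg _)
    _ = (∑ u, |A u w|) * k4c := (Finset.sum_mul _ _ _).symm
    _ ≤ αc * k4c := mul_le_mul_of_nonneg_right (hαc w) hk4c0

/-! ## §2. THE ENDS: the three triple sums -/

omit [DecidableEq ι] [DecidableEq κ] in
/-- **`Σ_{y,z,t} E(k^{xyz}, b^t) ≤ αr·k4r·(αc·hc)·dr·dc∕c`** (the lone gradient slot last; `x` inside the third-derivative entry). [folklore] -/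
theorem two_point_lone_last_sum_le [Nonempty κ] (hK40 : ∀ x y z u, 0 ≤ K4 x y z u) (hHk0 : ∀ v u, 0 ≤ Hk v u)
    (hαr : ∀ u, ∑ w, |A u w| ≤ αr) (hαc : ∀ w, ∑ u, |A u w| ≤ αc) (hhc : ∀ u, ∑ v, Hk v u ≤ hc) (hk4r : ∀ x, ∑ y, ∑ z, ∑ u, K4 x y z u ≤ k4r)
    (hD : ∀ x y, 0 ≤ D x y) (hDr : ∀ z, ∑ w, D z w ≤ dr) (hDc : ∀ w, ∑ z, D z w ≤ dc) (hcpos : 0 < c) (x : ι) :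
    ∑ y, ∑ z, ∑ t, ∑ w, (∑ z', D z' w * ∑ u, |A u z'| * K4 x y z u) * (∑ z', D z' w * ∑ u, |A u z'| * Hk t u) / c ≤
      αr * k4r * (αc * hc) * dr * dc / c := by
  haveI : Nonempty ι := ⟨x⟩
  obtain ⟨w₀⟩ := ‹Nonempty κ›
  have hdr : 0 ≤ dr := (Finset.sum_nonneg fun w _ => hD w₀ w).trans (hDr w₀)
  have hdc : 0 ≤ dc := (Finset.sum_nonneg fun z _ => hD z w₀).trans (hDc w₀)
  have hκc : 0 ≤ αc * hc := (Finset.sum_nonneg fun v _ => Finset.sum_nonneg fun u _ => mul_nonneg (abs_nonneg _) (hHk0 v u)).trans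
    (whitened_obs_colsum_le hHk0 hαc hhc w₀)
  have hin : ∀ y z, ∑ t, ∑ w, (∑ z', D z' w * ∑ u, |A u z'| * K4 x y z u) * (∑ z', D z' w * ∑ u, |A u z'| * Hk t u) / c ≤
      (∑ w, ∑ u, |A u w| * K4 x y z u) * (αc * hc) * dr * dc / c := fun y z =>
    two_point_family_sum_le (bf := fun t w => ∑ u, |A u w| * Hk t u) hD hDr hDc hcpos (fun w => third_vector_nonneg hK40 A x y z w)
      (fun t w => whitened_obs_nonneg hHk0 A t w) (fun w => whitened_obs_colsum_le hHk0 hαc hhc w)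
  have hfac : 0 ≤ (αc * hc) * dr * dc / c := by positivity
  calc _ ≤ ∑ y, ∑ z, (∑ w, ∑ u, |A u w| * K4 x y z u) * (αc * hc) * dr * dc / c := Finset.sum_le_sum fun y _ => Finset.sum_le_sum fun z _ => hin y z
    _ = (∑ y, ∑ z, ∑ w, ∑ u, |A u w| * K4 x y z u) * ((αc * hc) * dr * dc / c) := by
        rw [Finset.sum_mul]
        refine Finset.sum_congr rfl fun y _ => ?_
        rw [Finset.sum_mul]
        exact Finset.sum_congr rfl fun z _ => by ring
    _ ≤ αr * k4r * ((αc * hc) * dr * dc / c) := mul_le_mul_of_nonneg_right (third_vector_mass_le hK40 hαr hk4r x) hfac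
    _ = αr * k4r * (αc * hc) * dr * dc / c := by ring

omit [DecidableEq ι] [DecidableEq κ] in
/-- **`Σ_{y,z,t} E(b^x, k^{yzt}) ≤ hr·αr·(αc·k4c)·dr·dc∕c`** (`x` the lone gradient slot, first). [folklore] -/
theorem two_point_lone_first_sum_le [Nonempty κ] (hK40 : ∀ x y z u, 0 ≤ K4 x y z u) (hHk0 : ∀ v u, 0 ≤ Hk v u)
    (hαr : ∀ u, ∑ w, |A u w| ≤ αr) (hαc : ∀ w, ∑ u, |A u w| ≤ αc) (hhr : ∀ v, ∑ u, Hk v u ≤ hr) (hk4c : ∀ u, ∑ y, ∑ z, ∑ t, K4 y z t u ≤ k4c)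
    (hD : ∀ x y, 0 ≤ D x y) (hDr : ∀ z, ∑ w, D z w ≤ dr) (hDc : ∀ w, ∑ z, D z w ≤ dc) (hcpos : 0 < c) (x : ι) :
    ∑ y, ∑ z, ∑ t, ∑ w, (∑ z', D z' w * ∑ u, |A u z'| * Hk x u) * (∑ z', D z' w * ∑ u, |A u z'| * K4 y z t u) / c ≤
      hr * αr * (αc * k4c) * dr * dc / c := by
  haveI : Nonempty ι := ⟨x⟩
  obtain ⟨w₀⟩ := ‹Nonempty κ›
  have hdr : 0 ≤ dr := (Finset.sum_nonneg fun w _ => hD w₀ w).trans (hDr w₀)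
  have hdc : 0 ≤ dc := (Finset.sum_nonneg fun z _ => hD z w₀).trans (hDc w₀)
  have hκc : 0 ≤ αc * k4c := (Finset.sum_nonneg fun y _ => Finset.sum_nonneg fun z _ => Finset.sum_nonneg fun t _ =>
    third_vector_nonneg hK40 A y z t w₀).trans (third_vector_colsum_le hK40 hαc hk4c w₀)
  have h := two_point_family_sum_le (bf := fun p : ι × ι × ι => fun w => ∑ u, |A u w| * K4 p.1 p.2.1 p.2.2 u) (κc := αc * k4c) hD hDr hDc hcpos
    (fun w => whitened_obs_nonneg hHk0 A x w) (fun p w => third_vector_nonneg hK40 A p.1 p.2.1 p.2.2 w)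
    (fun w => by rw [triple_sum_eq (fun y z t => ∑ u, |A u w| * K4 y z t u)]; exact third_vector_colsum_le hK40 hαc hk4c w)
  rw [triple_sum_eq (fun y z t => ∑ w, (∑ z', D z' w * ∑ u, |A u z'| * Hk x u) * (∑ z', D z' w * ∑ u, |A u z'| * K4 y z t u) / c)] at h
  have hfac : 0 ≤ (αc * k4c) * dr * dc / c := by positivity
  calc _ ≤ (∑ w, ∑ u, |A u w| * Hk x u) * (αc * k4c) * dr * dc / c := h
    _ = (∑ w, ∑ u, |A u w| * Hk x u) * ((αc * k4c) * dr * dc / c) := by ring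
    _ ≤ hr * αr * ((αc * k4c) * dr * dc / c) := mul_le_mul_of_nonneg_right (whitened_obs_rowsum_le hHk0 hαr hhr x) hfac
    _ = hr * αr * (αc * k4c) * dr * dc / c := by ring

omit [DecidableEq ι] [DecidableEq κ] in
/-- **`Σ_{y,z,t} E(g^{xy}, g^{zt}) ≤ αr·k3r·(αc·k3c)·dr·dc∕c`** (each pairing of the Hessian–Hessian piece). [folklore] -/
theorem two_point_pairing_sum_le [Nonempty κ] (hK30 : ∀ x y u, 0 ≤ K3 x y u) (hαr : ∀ u, ∑ w, |A u w| ≤ αr) (hαc : ∀ w, ∑ u, |A u w| ≤ αc)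
    (hk3r : ∀ x, ∑ y, ∑ u, K3 x y u ≤ k3r) (hk3c : ∀ u, ∑ y, ∑ z, K3 y z u ≤ k3c)
    (hD : ∀ x y, 0 ≤ D x y) (hDr : ∀ z, ∑ w, D z w ≤ dr) (hDc : ∀ w, ∑ z, D z w ≤ dc) (hcpos : 0 < c) (x : ι) :
    ∑ y, ∑ z, ∑ t, ∑ w, (∑ z', D z' w * ∑ u, |A u z'| * K3 x y u) * (∑ z', D z' w * ∑ u, |A u z'| * K3 z t u) / c ≤
      αr * k3r * (αc * k3c) * dr * dc / c := by
  haveI : Nonempty ι := ⟨x⟩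
  obtain ⟨w₀⟩ := ‹Nonempty κ›
  have hdr : 0 ≤ dr := (Finset.sum_nonneg fun w _ => hD w₀ w).trans (hDr w₀)
  have hdc : 0 ≤ dc := (Finset.sum_nonneg fun z _ => hD z w₀).trans (hDc w₀)
  have hg0 : ∀ (p q : ι) (w : κ), 0 ≤ ∑ u, |A u w| * K3 p q u := fun p q w => Finset.sum_nonneg fun u _ => mul_nonneg (abs_nonneg _) (hK30 p q u)
  have hκc : 0 ≤ αc * k3c := (Finset.sum_nonneg fun y _ => Finset.sum_nonneg fun z _ => hg0 y z w₀).trans (hessian_obs_colsum hK30 hαc hk3c w₀)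
  have hin : ∀ y, ∑ z, ∑ t, ∑ w, (∑ z', D z' w * ∑ u, |A u z'| * K3 x y u) * (∑ z', D z' w * ∑ u, |A u z'| * K3 z t u) / c ≤
      (∑ w, ∑ u, |A u w| * K3 x y u) * (αc * k3c) * dr * dc / c := fun y =>
    two_point_pair_sum_le (g := fun p q w => ∑ u, |A u w| * K3 p q u) hD hDr hDc hcpos (fun w => hg0 x y w) hg0 (fun w => hessian_obs_colsum hK30 hαc
        hk3c w)
  have hfac : 0 ≤ (αc * k3c) * dr * dc / c := by positivity
  calc _ ≤ ∑ y, (∑ w, ∑ u, |A u w| * K3 x y u) * (αc * k3c) * dr * dc / c := Finset.sum_le_sum fun y _ => hin y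
    _ = (∑ y, ∑ w, ∑ u, |A u w| * K3 x y u) * ((αc * k3c) * dr * dc / c) := by
        rw [Finset.sum_mul]
        exact Finset.sum_congr rfl fun y _ => by ring
    _ ≤ αr * k3r * ((αc * k3c) * dr * dc / c) := mul_le_mul_of_nonneg_right (hessian_obs_mass_le hK30 hαr hk3r x) hfac
    _ = αr * k3r * (αc * k3c) * dr * dc / c := by ring

/-! ## §3. Toy -/

/-- Toy (§1's mass in numbers): `Σ_{y,z,w,u ∈ {0}} 1·1 ≤ 1·1`. -/
example : ∑ _y : Fin 1, ∑ _z : Fin 1, ∑ _w : Fin 1, ∑ _u : Fin 1, |(1 : ℝ)| * 1 ≤ 1 * 1 := by simp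

end Summit.QuantumFields.BalabanUV.T4Continuum.NE7b.SupFourthKernelTwoPointLetters

end
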